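import Literature.MathematicalPhysics.QuantumLattice.LatticeGaugeDLRGibbsProofs
import HarnessLib

/-!
# T5: sums of translates integrate to `#X` times the integral in a translation-invariant state

Helper (T5 of the "tangent programme") of crux `FibreToTorus` (stmt-QuantumFields-16244), line
`Sketch`, route `ContractibleFibre`: a bookkeeping step of the reduction of weak-coupling
uniqueness of translation-invariant DLR states to uniqueness of the pressure tangent
(Israel 1979, Thm. V.2.2 style; Friedli–Velenik 2017 §6.9, transcribed to lattice gauge theory).

For a translation-invariant probability measure `μ` on lattice gauge configurations on `ℤ^d`, a
bounded measurable observable `F` and a finite set of sites `X`,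
`∫ ∑_{x ∈ X} F (θ_{-x} U) dμ(U) = #X · ∫ F dμ`.

Proof: swap the finite sum and the integral (`integral_finsetSum`; each translate `F ∘ θ_{-x}`
is bounded and measurable, hence integrable for the finite measure `μ`), rewrite each term by the
change of variables `U ↦ θ_{-x} U` (`integral_map_equiv`) and translation invariance
`μ ∘ θ_{-x}⁻¹ = μ`, and sum the constant (`Finset.sum_const`, `nsmul_eq_mul`).
-/

noncomputable section

open MeasureTheory Filter Topology Finset
open Literature.Probability.LatticeModels (Site)
open Literature.MathematicalPhysics.QuantumLattice (LGConfig ZdEdge configShift configShift_apply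
  IsZdTranslationInvariant integrable_of_bound)

namespace Summit.QuantumFields.YangMills.Theorems.FibreToTorus

/-- In a translation-invariant state the mean of a translate of an observable equals the mean of
the observable: `∫ F (θ_v U) dμ = ∫ F dμ`, by the change of variables `U ↦ θ_v U`
(Georgii 2011 (5.4)). [folklore] -/
theorem tangentT5_integral_configShift_eq {d : ℕ} {G : Type*} [MeasurableSpace G]
    {μ : Measure (LGConfig d G)} (hμ : IsZdTranslationInvariant μ) (F : LGConfig d G → ℝ)
    (v : Site d) : ∫ U, F (configShift v U) ∂μ = ∫ U, F U ∂μ := by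
  rw [← integral_map_equiv (configShift v) F, hμ v]

/-- A translate `F ∘ θ_v` of a bounded measurable observable is integrable for every finite
measure on configurations. [folklore] -/
theorem tangentT5_integrable_comp_configShift {d : ℕ} {G : Type*} [MeasurableSpace G]
    (μ : Measure (LGConfig d G)) [IsFiniteMeasure μ] {F : LGConfig d G → ℝ} (hF : Measurable F)
    {C : ℝ} (hC : ∀ U, |F U| ≤ C) (v : Site d) :
    Integrable (fun U => F (configShift v U)) μ :=
  integrable_of_bound (hF.comp (configShift v).measurable).aestronglyMeasurable fun U =>
    hC (configShift v U)

/-- **T5: sums of translates in a translation-invariant state.** For a translation-invariant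
probability measure `μ` on lattice gauge configurations on `ℤ^d`, a bounded measurable
observable `F` and a finite set of sites `X`, `∫ ∑_{x ∈ X} F (θ_{-x} U) dμ(U) = #X · ∫ F dμ`:
swap sum and integral, use `∫ F ∘ θ_{-x} dμ = ∫ F d(μ ∘ θ_{-x}⁻¹) = ∫ F dμ` for every `x`, and
sum the constant (Georgii 2011 (5.4); Friedli–Velenik 2017 §6.9). [folklore] -/
theorem tangent_integral_sum_translates : ∀ (d : ℕ) (G : Type) [MeasurableSpace G] (μ : MeasureTheory.Measure (LGConfig d G)), MeasureTheory.IsProbabilityMeasure μ → IsZdTranslationInvariant μ → ∀ (F : LGConfig d G → ℝ), Measurable F → (∃ C : ℝ, ∀ U, |F U| ≤ C) → ∀ (X : Finset (Site d)), ∫ U, ∑ x ∈ X, F (configShift (-x) U) ∂μ = #X * ∫ U, F U ∂μ := by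
  intro d G _ μ hμP hμT F hF hC X
  obtain ⟨C, hC⟩ := hC
  rw [integral_finsetSum X fun x _ => tangentT5_integrable_comp_configShift μ hF hC (-x)]
  simp_rw [tangentT5_integral_configShift_eq hμT F]
  rw [Finset.sum_const, nsmul_eq_mul]

end Summit.QuantumFields.YangMills.Theorems.FibreToTorus

end
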